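import Summits.QuantumFields.YangMills.Theorems.IR.BlockedActivityWStrongCouplingMeshPrep
import Summits.QuantumFields.YangMills.Theorems.IR.BlockedActivityWSharp
import HarnessLib

/-!
# Crux `IR` (stmt-QuantumFields-19354), lane B «strong coupling AFTER BLOCKING»: the W-class of record at EVERY mesh, uniformly in the
# strong window `216·N·|β| ≤ 1`, with radius `≍ b⁴·2^{−2nb}` (centre-cell ratio mixing by Dobrushin + the single-cell tilt)

Helper module for item `stmt-QuantumFields-19354` (`--supports`; it closes nothing), lane `ym-19354-onsetsc-p2` (g3).

THE THEOREM.  For every compact `G`, every lattice representation `r` (`N = r.N`), every `β` with `216·N·|β| ≤ 1`, every mesh `b ≥ 1` and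
window `n ≥ 1`:  `BlockedActivityClassW r.ρ β b n (meshRadiusSC r.N β b n)` with
`meshRadiusSC N β b n = exp(3072 · b⁴ · e^{24 N |β|} · 2^{−2nb}) − 1` (`blockedActivityClassW_strongCoupling_mesh`), hence the W|Typ classes
`BlockedActivityTypW(All)` for EVERY class `Typ` on every frame; the radius tends to `0` as `b → ∞` uniformly in the strong window, so for every
radius `a > 0` the class holds at ALL large meshes (`blockedActivityClassW_strongCoupling_eventually`); certified instance: at `(b, n) = (32, 1)`
the radius is below `radiusKP (1∕3552)` (the KP hand-over radius `a⋆` of the activity axis), whence `UnivShellCond r.ρ β 32 1 (1∕3552)` back through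
the tree's reduction — a hand-over INTO the activity ball AFTER BLOCKING, certified, where the tree so far had only the mesh-1 calibration receding
like `b⁻⁴` (`BlockedActivityCalibrationMesh`, p541588: re-indexing WITHOUT integrating out).

THE MECHANISM (the strong-coupling «integrating-out dictionary» is one conditional expectation).  By `Theorems/IR/BlockedActivityWCentreRatio`
the class needs only a multiplicative oscillation bound for the centre-conditioned boundary ratio `q_σ(U) = centreRatio r.ρ β w Y σ τ U`
(`σ` in the agreement class of the window datum `τ`).  Switching the centre links of `U` to those of `U'` one link `a` at a time
(`#cellEdges ≤ 64 b⁴` steps), each step multiplies `q_σ` by `∫ E_a dγ_{Λ'}(·|ζ^σ) ∕ ∫ E_a dγ_{Λ'}(·|ζ)` (one-link change of exterior, tree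
`integral_ymSpecification_update_eq`, then the change-of-exterior identity on the INNER volume), where `E_a ∈ [e^{−c}, e^{c}]`, `c ≤ 12N|β|`, is
the one-link Boltzmann ratio (a cylinder on the `≤ 24` links of the plaquettes through `a`) and the two exteriors differ only OUTSIDE the window,
at sup-distance `> 2nb` from `a` (frame geometry: `far_of_not_mem_windowRegion`).  The NT lane's general-volume Dobrushin engine
`NT.StrongCoupling.abs_kerInt_sub_le_of_agree_ball` (row sums `≤ 1∕2` at `216N|β| ≤ 1`) bounds the step by `1 + 48 e^{2c} 2^{−2nb}`.

HONEST FRAMING: a strong-coupling theorem about the lane's currency of record (the NON-LOCAL W-class; the finite-range axiom idles,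
`blockedRepOn_of_tilt`; the LOCAL class `BlockedRepOnLoc`, p547052, is not touched); nothing about weak coupling, a gap or Clay.  No `sorry`;
axioms ⊆ {propext, Classical.choice, Quot.sound}; no instances, no notation.  Refs: Dobrushin 1970 Thm. 3; Georgii 2011 Thm. 8.20;
Chatterjee CMP 385 (2021) §7; Dobrushin–Shlosman 1987; FriedliVelenik2017 §5.7.1.
-/

set_option autoImplicit false

noncomputable section

open MeasureTheory ProbabilityTheory
open Literature.MathematicalPhysics.QuantumLattice
open Literature.Probability.LatticeModels
open Summit.QuantumFields.YangMills.Cruxes.IR.Tempered (cellEdges windowCells regionEdges collarEdges)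
open Summit.QuantumFields.YangMills.Cruxes.IR.CellTempered.Engine (frameCell frameCell_eq_iff mem_cellEdges_frameCell frame_hC1
  frame_add_nat_le shiftFrame shiftFrame_mesh)

namespace Summit.QuantumFields.YangMills.Cruxes.IR.BlockedActivity
/-! ## §3 The one-step ratio bound at strong coupling and the telescoping over the centre links -/

section Step

variable (G : Type) [Group G] [TopologicalSpace G] [IsTopologicalGroup G] [CompactSpace G] [MeasurableSpace G] [BorelSpace G]
  (r : Literature.MathematicalPhysics.QuantumFieldTheory.LatticeRep G)
  {β : ℝ} {w : Fin 4 → ℤ → ℤ} {b n : ℕ} {Y : Finset Cell} {σ τ : LGConfig 4 G}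

omit [IsTopologicalGroup G] [CompactSpace G] [MeasurableSpace G] [BorelSpace G] in
/-- The exponent of the one-link ratio is bounded by `12 N |β|` (`≤ 6` plaquettes through a link, `|Re tr ρ(U_p)| ≤ N` for unitary `ρ`). -/
theorem abs_log_linkRatio_le (a : ZdEdge 4) (x : G) (V : LGConfig 4 G) :
    |-β * (wilsonBoundaryAction r.ρ (innerEdges w Y) (Function.update V a x) - wilsonBoundaryAction r.ρ (innerEdges w Y) V)| ≤
      12 * r.N * |β| := by
  have hC := abs_plaquetteObs_le_holds (d := 4) r.ρ r.mem_unitary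
  rw [abs_mul, abs_neg]
  have h := abs_wilsonBoundaryAction_sub_le r.ρ (Nat.cast_nonneg r.N) hC (innerEdges w Y) {a} (U := Function.update V a x) (U' := V)
    fun e he => Function.update_of_ne (by simpa using he) _ _
  have hcard : ((plaquettesTouching ({a} : Finset (ZdEdge 4))).card : ℝ) ≤ 6 := by
    exact_mod_cast (Literature.MathematicalPhysics.QuantumFieldTheory.card_plaquettesTouching_singleton_le a)
  calc |β| * |wilsonBoundaryAction r.ρ (innerEdges w Y) (Function.update V a x) - wilsonBoundaryAction r.ρ (innerEdges w Y) V|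
      ≤ |β| * (2 * r.N * 6) := mul_le_mul_of_nonneg_left (h.trans (by nlinarith [Nat.cast_nonneg (α := ℝ) r.N])) (abs_nonneg β)
    _ = 12 * r.N * |β| := by ring

omit [IsTopologicalGroup G] [CompactSpace G] [MeasurableSpace G] [BorelSpace G] in
/-- Two-sided bounds of the one-link ratio: `e^{−12N|β|} ≤ E_a ≤ e^{12N|β|}`. -/
theorem linkRatio_bounds (a : ZdEdge 4) (x : G) (V : LGConfig 4 G) :
    Real.exp (-(12 * r.N * |β|)) ≤ linkRatio r.ρ β w Y a x V ∧ linkRatio r.ρ β w Y a x V ≤ Real.exp (12 * r.N * |β|) := by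
  have h := abs_le.1 (abs_log_linkRatio_le G r (β := β) (w := w) (Y := Y) a x V)
  exact ⟨Real.exp_le_exp.2 h.1, Real.exp_le_exp.2 h.2⟩

/-- **The one-step ratio bound.**  At `216·N·|β| ≤ 1`, for a mesh-`b` frame (`b ≥ 1`), window `n ≥ 1`, `σ` in the agreement class of `τ`,
an exterior `ζ = τ` off the region and a centre link `a`:  updating `ζ` at `a` multiplies the inner-kernel average of the boundary ratio by at
most `exp(48 e^{24N|β|} 2^{−2nb})`. -/
theorem inner_integral_update_le (hβ : 216 * (r.N : ℝ) * |β| ≤ 1) (hw : AfPincerUc.IsFrame b w) (hb : 1 ≤ b) (hn : 1 ≤ n)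
    (hσ : σ ∈ WindowAgree w n Y τ) {ζ : LGConfig 4 G} (hζ : ∀ e ∉ regionEdges w Y, ζ e = τ e)
    {a : ZdEdge 4} (ha : a ∈ cellEdges w 0) (x : G) :
    ∫ V, bcRatio r.ρ β (regionEdges w Y) σ τ V ∂(ymSpecification r.ρ β (innerEdges w Y) (Function.update ζ a x)) ≤
      Real.exp (48 * Real.exp (24 * r.N * |β|) * (1 / 2 : ℝ) ^ (2 * n * b)) *
        ∫ V, bcRatio r.ρ β (regionEdges w Y) σ τ V ∂(ymSpecification r.ρ β (innerEdges w Y) ζ) := by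
  haveI := r.t2Space
  haveI := r.secondCountableTopology
  have hρ := r.continuous
  have hγ := Literature.MathematicalPhysics.QuantumFieldTheory.isSpecification_ymSpecification_of_t2Space (d := 4) r.ρ hρ β
  set Λ := regionEdges w Y with hΛ
  set Λ' := innerEdges w Y with hΛ'
  set Φ := bcRatio r.ρ β Λ σ τ with hΦ
  set E := linkRatio r.ρ β w Y a x with hE
  set ζσ := splice Λ ζ σ with hζσ
  haveI := hγ.isProbability Λ' ζ
  haveI := hγ.isProbability Λ' ζσ
  have haΛ' : a ∉ Λ' := not_mem_innerEdges_of_mem_cellEdges w Y ha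
  have hΦm : Measurable Φ := measurable_bcRatio r.ρ hρ β Λ σ τ
  have hEm : Measurable E := by
    refine (Real.continuous_exp.comp (continuous_const.mul ?_)).measurable
    exact ((continuous_wilsonBoundaryAction r.ρ hρ Λ').comp (continuous_id.update a continuous_const)).sub
      (continuous_wilsonBoundaryAction r.ρ hρ Λ')
  set c : ℝ := 12 * r.N * |β| with hc
  have hEb : ∀ V, Real.exp (-c) ≤ E V ∧ E V ≤ Real.exp c := fun V => linkRatio_bounds G r a x V
  -- (1) one-link change of exterior: `∫ Φ dγ(ζ^{a←x}) = ∫ Φ E dγ(ζ) / ∫ E dγ(ζ)`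
  have h1 : ∫ V, Φ V ∂(ymSpecification r.ρ β Λ' (Function.update ζ a x)) =
      (∫ V, Φ V * E V ∂(ymSpecification r.ρ β Λ' ζ)) / ∫ V, E V ∂(ymSpecification r.ρ β Λ' ζ) :=
    integral_ymSpecification_update_eq r.ρ hρ β Λ' ζ haΛ' x hΦm fun V => bcRatio_update_centre r.ρ hw hb hn hσ β ha V x
  -- (2) change of exterior on the inner volume: `∫ E dγ(ζσ) = ∫ E Φ' dγ(ζ) / ∫ Φ' dγ(ζ)` and `Φ' = Φ` a.e.
  have h2 : ∫ V, E V ∂(ymSpecification r.ρ β Λ' ζσ) =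
      (∫ V, E V * Φ V ∂(ymSpecification r.ρ β Λ' ζ)) / ∫ V, Φ V ∂(ymSpecification r.ρ β Λ' ζ) := by
    rw [integral_ymSpecification_eq_div_bcRatio r.ρ hρ β Λ' ζσ ζ hEm
      (fun u => linkRatio_glueWith_eq r.ρ hw hb hn hσ β hζ ha x u)]
    have hae : ∀ᵐ V ∂(ymSpecification r.ρ β Λ' ζ), bcRatio r.ρ β Λ' ζσ ζ V = Φ V := by
      filter_upwards [hγ.proper Λ' ζ] with V hV
      exact (bcRatio_region_eq_inner r.ρ hw hb hn hσ β hζ hV).symm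
    rw [integral_congr_ae (hae.mono fun V hV => by rw [hV] : ∀ᵐ V ∂(ymSpecification r.ρ β Λ' ζ),
      E V * bcRatio r.ρ β Λ' ζσ ζ V = E V * Φ V), integral_congr_ae hae]
  -- positivity
  have hJpos : 0 < ∫ V, Φ V ∂(ymSpecification r.ρ β Λ' ζ) := by
    have := centreRatio_pos (ρ := r.ρ) hρ β w Y σ τ ζ
    simp only [centreRatio, ← hΛ, ← hΛ', splice_eq_self Λ hζ] at this
    exact this
  have hEint : ∀ η : LGConfig 4 G, Real.exp (-c) ≤ ∫ V, E V ∂(ymSpecification r.ρ β Λ' η) := fun η => by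
    haveI := hγ.isProbability Λ' η
    have hi : Integrable E (ymSpecification r.ρ β Λ' η) := Integrable.of_bound hEm.aestronglyMeasurable (Real.exp c)
      (ae_of_all _ fun V => by rw [Real.norm_eq_abs, abs_of_pos ((Real.exp_pos _).trans_le (hEb V).1)]; exact (hEb V).2)
    have := integral_mono (integrable_const (Real.exp (-c))) hi fun V => (hEb V).1
    simpa using this
  have hEpos : 0 < ∫ V, E V ∂(ymSpecification r.ρ β Λ' ζ) := (Real.exp_pos _).trans_le (hEint ζ)
  -- (3) the ratio of the two steps
  have h3 : ∫ V, Φ V ∂(ymSpecification r.ρ β Λ' (Function.update ζ a x)) =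
      (∫ V, Φ V ∂(ymSpecification r.ρ β Λ' ζ)) * ((∫ V, E V ∂(ymSpecification r.ρ β Λ' ζσ)) / ∫ V, E V ∂(ymSpecification r.ρ β Λ' ζ)) := by
    rw [h1, h2]
    have : (fun V => Φ V * E V) = fun V => E V * Φ V := funext fun V => mul_comm _ _
    rw [this]
    field_simp
  -- (4) the Dobrushin engine: the two exteriors differ only off the window, at sup-distance `> 2nb` from `a`
  have hagree : ∀ z : ZdEdge 4, z ∉ Λ' → ⌊‖z.1 - a.1‖⌋₊ ≤ 2 * n * b → ζσ z = ζ z := by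
    intro z hz hdist
    by_cases hzΛ : z ∈ Λ
    · exact splice_apply_mem _ _ _ hzΛ
    · rw [hζσ, splice_apply_not_mem _ _ _ hzΛ, hζ z hzΛ]
      have hzw : z ∈ regionEdges w (windowCells n) := by
        by_contra hzw
        have hya : ∀ k, w k 0 ≤ a.1 k ∧ a.1 k < w k 1 := by
          have := ha
          simp only [Summit.QuantumFields.YangMills.Cruxes.IR.Tempered.cellEdges, Finset.mem_product, Fintype.mem_piFinset,
            Finset.mem_Ico, Pi.zero_apply, zero_add] at this
          exact this.1
        have := far_of_not_mem_windowRegion hw hb hzw hya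
        omega
      exact eq_of_mem_windowAgree hσ hzw hzΛ
  have h4 : |(∫ V, E V ∂(ymSpecification r.ρ β Λ' ζσ)) - ∫ V, E V ∂(ymSpecification r.ρ β Λ' ζ)| ≤
      2 * Real.exp c * 24 * (1 / 2 : ℝ) ^ (2 * n * b) := by
    have h := NT.StrongCoupling.abs_kerInt_sub_le_of_agree_ball G r hβ Λ' ζσ ζ a.1 (2 * n * b) hagree hEm
      (dependsOn_linkRatio r.ρ β a x) (M := Real.exp c) (fun V => by
        rw [abs_of_pos ((Real.exp_pos _).trans_le (hEb V).1)]; exact (hEb V).2)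
      (ρ₀ := 1) (fun z hz => floor_norm_le_one_of_mem_plaqNbhd hz)
    refine h.trans ?_
    have hcard : (((plaquettesTouching ({a} : Finset (ZdEdge 4))).biUnion plaquetteEdges).card : ℝ) ≤ 24 := by
      exact_mod_cast card_plaqNbhd_le a
    have hexp : (1 / 2 : ℝ) ^ (2 * n * b + 1 - 1) = (1 / 2 : ℝ) ^ (2 * n * b) := by rw [Nat.add_sub_cancel]
    rw [hexp]
    have h0 : 0 ≤ 2 * Real.exp c * (1 / 2 : ℝ) ^ (2 * n * b) := by positivity
    nlinarith
  -- (5) assemble: the step ratio is `≤ 1 + 48 e^{2c} 2^{-2nb} ≤ exp(48 e^{24N|β|} 2^{-2nb})`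
  have hstep : (∫ V, E V ∂(ymSpecification r.ρ β Λ' ζσ)) / ∫ V, E V ∂(ymSpecification r.ρ β Λ' ζ) ≤
      Real.exp (48 * Real.exp (24 * r.N * |β|) * (1 / 2 : ℝ) ^ (2 * n * b)) := by
    rw [div_le_iff₀ hEpos]
    have hnum : ∫ V, E V ∂(ymSpecification r.ρ β Λ' ζσ) ≤ ∫ V, E V ∂(ymSpecification r.ρ β Λ' ζ) +
        2 * Real.exp c * 24 * (1 / 2 : ℝ) ^ (2 * n * b) := by linarith [(abs_le.1 h4).2]
    have hden := hEint ζ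
    have hkey : 2 * Real.exp c * 24 * (1 / 2 : ℝ) ^ (2 * n * b) ≤
        (48 * Real.exp (24 * r.N * |β|) * (1 / 2 : ℝ) ^ (2 * n * b)) * ∫ V, E V ∂(ymSpecification r.ρ β Λ' ζ) := by
      have h2c : Real.exp c * Real.exp c = Real.exp (24 * r.N * |β|) := by rw [← Real.exp_add]; congr 1; rw [hc]; ring
      have hcc : Real.exp c * Real.exp (-c) = 1 := by rw [← Real.exp_add, add_neg_cancel, Real.exp_zero]
      have hp : 0 ≤ (1 / 2 : ℝ) ^ (2 * n * b) := by positivity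
      calc 2 * Real.exp c * 24 * (1 / 2 : ℝ) ^ (2 * n * b)
          = (48 * Real.exp (24 * r.N * |β|) * (1 / 2 : ℝ) ^ (2 * n * b)) * Real.exp (-c) := by
            rw [← h2c]
            have hre : (48 * (Real.exp c * Real.exp c) * (1 / 2 : ℝ) ^ (2 * n * b)) * Real.exp (-c) =
                48 * Real.exp c * (1 / 2 : ℝ) ^ (2 * n * b) * (Real.exp c * Real.exp (-c)) := by ring
            rw [hre, hcc]; ring
        _ ≤ (48 * Real.exp (24 * r.N * |β|) * (1 / 2 : ℝ) ^ (2 * n * b)) * ∫ V, E V ∂(ymSpecification r.ρ β Λ' ζ) :=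
            mul_le_mul_of_nonneg_left hden (by positivity)
    have hx := Real.add_one_le_exp (48 * Real.exp (24 * r.N * |β|) * (1 / 2 : ℝ) ^ (2 * n * b))
    nlinarith [hEpos]
  rw [h3, mul_comm]
  exact mul_le_mul_of_nonneg_right hstep hJpos.le

/-- **Telescoping over the centre links.**  Switching the centre links of the exterior from `U` to `U'` on a set `D` of centre links
multiplies the inner-kernel average of the boundary ratio by at most `exp(#D · 48 e^{24N|β|} 2^{−2nb})`. -/
theorem inner_integral_switch_le (hβ : 216 * (r.N : ℝ) * |β| ≤ 1) (hw : AfPincerUc.IsFrame b w) (hb : 1 ≤ b) (hn : 1 ≤ n)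
    (hY : cellEdges w 0 ⊆ regionEdges w Y) (hσ : σ ∈ WindowAgree w n Y τ) (U U' : LGConfig 4 G) (D : Finset (ZdEdge 4))
    (hD : D ⊆ cellEdges w 0) :
    ∫ V, bcRatio r.ρ β (regionEdges w Y) σ τ V ∂(ymSpecification r.ρ β (innerEdges w Y)
        (fun e => if e ∈ D then U' e else splice (regionEdges w Y) U τ e)) ≤
      Real.exp (D.card * (48 * Real.exp (24 * r.N * |β|) * (1 / 2 : ℝ) ^ (2 * n * b))) *
        ∫ V, bcRatio r.ρ β (regionEdges w Y) σ τ V ∂(ymSpecification r.ρ β (innerEdges w Y) (splice (regionEdges w Y) U τ)) := by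
  classical
  set x : ℝ := 48 * Real.exp (24 * r.N * |β|) * (1 / 2 : ℝ) ^ (2 * n * b) with hx
  induction D using Finset.induction_on with
  | empty => simp
  | @insert a D haD ih =>
    have hD' : D ⊆ cellEdges w 0 := fun e he => hD (Finset.mem_insert_of_mem he)
    have ha : a ∈ cellEdges w 0 := hD (Finset.mem_insert_self a D)
    set ζ : LGConfig 4 G := fun e => if e ∈ D then U' e else splice (regionEdges w Y) U τ e with hζdef
    have hζ : ∀ e ∉ regionEdges w Y, ζ e = τ e := fun e he => by
      have heD : e ∉ D := fun heD => he (hY (hD' heD))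
      simp only [hζdef, heD, if_false, splice_apply_not_mem _ _ _ he]
    have hupd : (fun e => if e ∈ insert a D then U' e else splice (regionEdges w Y) U τ e) = Function.update ζ a (U' a) := by
      funext e
      by_cases hea : e = a
      · subst hea; simp [hζdef]
      · rw [Function.update_of_ne hea]
        simp [hζdef, Finset.mem_insert, hea]
    rw [hupd, Finset.card_insert_of_notMem haD]
    have hstep := inner_integral_update_le G r hβ hw hb hn hσ hζ ha (U' a)
    refine hstep.trans ?_
    have hih := ih hD'
    have hxe : 0 ≤ Real.exp x := (Real.exp_pos x).le
    calc Real.exp x * ∫ V, bcRatio r.ρ β (regionEdges w Y) σ τ V ∂(ymSpecification r.ρ β (innerEdges w Y) ζ)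
        ≤ Real.exp x * (Real.exp (D.card * x) *
            ∫ V, bcRatio r.ρ β (regionEdges w Y) σ τ V ∂(ymSpecification r.ρ β (innerEdges w Y) (splice (regionEdges w Y) U τ))) :=
          mul_le_mul_of_nonneg_left hih hxe
      _ = Real.exp (((D.card + 1 : ℕ) : ℝ) * x) *
            ∫ V, bcRatio r.ρ β (regionEdges w Y) σ τ V ∂(ymSpecification r.ρ β (innerEdges w Y) (splice (regionEdges w Y) U τ)) := by
          rw [← mul_assoc, ← Real.exp_add]; congr 1; push_cast; ring

end Step

/-! ## §4 The class of record at every mesh in the strong window -/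

section Main

variable (G : Type) [Group G] [TopologicalSpace G] [IsTopologicalGroup G] [CompactSpace G] [MeasurableSpace G] [BorelSpace G]
  (r : Literature.MathematicalPhysics.QuantumFieldTheory.LatticeRep G)

/-- **THE NUMBER of this file**: the activity radius reached by the Wilson kernels at mesh `b`, window `n`, in the strong window,
`meshRadiusSC N β b n = exp(3072 · b⁴ · e^{24N|β|} · 2^{−2nb}) − 1` (`3072 = 64 · 48`: `≤ 64 b⁴` centre links, `48 = 2 · 24` from the engine). -/
def meshRadiusSC (N : ℕ) (β : ℝ) (b n : ℕ) : ℝ :=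
  Real.exp (3072 * (b : ℝ) ^ 4 * Real.exp (24 * N * |β|) * (1 / 2 : ℝ) ^ (2 * n * b)) - 1

/-- The exponent of `meshRadiusSC` is non-negative. -/
theorem meshRadiusSC_exponent_nonneg (N : ℕ) (β : ℝ) (b n : ℕ) :
    0 ≤ 3072 * (b : ℝ) ^ 4 * Real.exp (24 * N * |β|) * (1 / 2 : ℝ) ^ (2 * n * b) := by positivity
/-- **Centre-cell RATIO mixing at strong coupling, every mesh.**  At `216·N·|β| ≤ 1`, on a mesh-`b` frame (`b ≥ 1`), for a region `Y ∋ 0` of the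
`n`-window (`n ≥ 1`) and data `σ` agreeing with `τ` on the window: the centre-conditioned ratio oscillates multiplicatively by at most
`exp(3072 b⁴ e^{24N|β|} 2^{−2nb})`. -/
theorem centreRatio_le_exp_mul_strongCoupling {β : ℝ} (hβ : 216 * (r.N : ℝ) * |β| ≤ 1) {w : Fin 4 → ℤ → ℤ} {b n : ℕ}
    (hw : AfPincerUc.IsFrame b w) (hb : 1 ≤ b) (hn : 1 ≤ n) {Y : Finset Cell} (h0 : (0 : Cell) ∈ Y) {σ τ : LGConfig 4 G}
    (hσ : σ ∈ WindowAgree w n Y τ) (U U' : LGConfig 4 G) :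
    centreRatio r.ρ β w Y σ τ U' ≤
      Real.exp (3072 * (b : ℝ) ^ 4 * Real.exp (24 * r.N * |β|) * (1 / 2 : ℝ) ^ (2 * n * b)) * centreRatio r.ρ β w Y σ τ U := by
  classical
  haveI := r.t2Space
  haveI := r.secondCountableTopology
  have hρ := r.continuous
  have hY : cellEdges w 0 ⊆ regionEdges w Y := Tempered.cellEdges_subset_regionEdges w h0
  set x : ℝ := 48 * Real.exp (24 * r.N * |β|) * (1 / 2 : ℝ) ^ (2 * n * b) with hx
  -- switch ALL centre links: the resulting exterior agrees with the splice of `U'` off the inner volume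
  have hsw := inner_integral_switch_le G r hβ hw hb hn hY hσ U U' (cellEdges w 0) subset_rfl
  have hcongr : ∫ V, bcRatio r.ρ β (regionEdges w Y) σ τ V ∂(ymSpecification r.ρ β (innerEdges w Y)
        (fun e => if e ∈ cellEdges w 0 then U' e else splice (regionEdges w Y) U τ e)) = centreRatio r.ρ β w Y σ τ U' := by
    unfold centreRatio
    refine integral_ymSpecification_congr_of_eqOn r.ρ hρ β (innerEdges w Y) (S := regionEdges w Y)
      (measurable_bcRatio r.ρ hρ β _ σ τ) (fun V V' h => bcRatio_eq_of_eqOn r.ρ β _ σ τ fun e he => h e (Finset.mem_coe.2 he))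
      fun e he _ => ?_
    by_cases hec : e ∈ cellEdges w 0
    · simp only [hec, if_true, splice_apply_mem _ _ _ (hY hec)]
    · simp only [hec, if_false]
      have heΛ : e ∉ regionEdges w Y := fun heΛ => he (Finset.mem_sdiff.2 ⟨heΛ, hec⟩)
      rw [splice_apply_not_mem _ _ _ heΛ, splice_apply_not_mem _ _ _ heΛ]
  rw [hcongr] at hsw
  refine hsw.trans (mul_le_mul_of_nonneg_right ?_ (centreRatio_pos hρ β w Y σ τ U).le)
  refine Real.exp_le_exp.2 ?_
  have hcard : ((cellEdges w 0).card : ℝ) ≤ 64 * (b : ℝ) ^ 4 := by exact_mod_cast card_cellEdges_le_mesh hw 0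
  have hx0 : 0 ≤ x := by positivity
  calc ((cellEdges w 0).card : ℝ) * x ≤ 64 * (b : ℝ) ^ 4 * x := mul_le_mul_of_nonneg_right hcard hx0
    _ = 3072 * (b : ℝ) ^ 4 * Real.exp (24 * r.N * |β|) * (1 / 2 : ℝ) ^ (2 * n * b) := by rw [hx]; ring

/-- **STRONG COUPLING AFTER BLOCKING — the W-class of record at EVERY mesh, uniformly in the strong window.**  For every compact `G`, lattice
representation `r`, `216·N·|β| ≤ 1`, mesh `b ≥ 1` and window `n ≥ 1`:  `BlockedActivityClassW r.ρ β b n (meshRadiusSC r.N β b n)`. -/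
theorem blockedActivityClassW_strongCoupling_mesh {β : ℝ} (hβ : 216 * (r.N : ℝ) * |β| ≤ 1) {b n : ℕ} (hb : 1 ≤ b) (hn : 1 ≤ n) :
    BlockedActivityClassW r.ρ β b n (meshRadiusSC r.N β b n) := by
  haveI := r.t2Space
  haveI := r.secondCountableTopology
  exact blockedActivityClassW_of_centreRatio_le r.continuous (meshRadiusSC_exponent_nonneg r.N β b n)
    fun w hw Y _ h0 τ σ hσ U U' => centreRatio_le_exp_mul_strongCoupling G r hβ hw hb hn h0 hσ U' U

/-- … hence the W|Typ class at every frame for EVERY class `Typ`, and at every centre (`BlockedActivityTypWAll`, the `Act`-shape of the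
supplier target of record `…TolG`): at strong coupling the activity conjunct is inhabited at every large mesh whatever `Typ` is. -/
theorem blockedActivityTypWAll_strongCoupling_mesh {β : ℝ} (hβ : 216 * (r.N : ℝ) * |β| ≤ 1) {b n : ℕ} (hb : 1 ≤ b) (hn : 1 ≤ n)
    {w : Fin 4 → ℤ → ℤ} (hw : AfPincerUc.IsFrame b w) (Typ : Cell → Set (LGConfig 4 G)) :
    BlockedActivityTypWAll r.ρ β w n (meshRadiusSC r.N β b n) Typ := fun c₀ =>
  blockedActivityTypW_of_blockedActivityClassW (blockedActivityClassW_strongCoupling_mesh G r hβ hb hn) (shiftFrame_mesh hw c₀) _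

/-- Weakening the radius of a blocked representation. -/
def BlockedRepOn.weaken {N : ℕ} {ρ : G →* Matrix (Fin N) (Fin N) ℂ} {β : ℝ} {w : Fin 4 → ℤ → ℤ} {Y : Finset Cell} {a a' : ℝ}
    {S : Set (LGConfig 4 G)} (R : BlockedRepOn ρ β w Y a S) (h : a ≤ a') : BlockedRepOn ρ β w Y a' S where
  Ω := R.Ω
  mΩ := R.mΩ
  μ := R.μ
  isProb := R.isProb
  𝓕 := R.𝓕
  C := R.C
  g := R.g; obs := R.obs
  perturbation σ hσ :=
    { le := (R.perturbation σ hσ).le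
      indep := (R.perturbation σ hσ).indep
      measurable := (R.perturbation σ hσ).measurable
      norm_le := fun p ω => ((R.perturbation σ hσ).norm_le p ω).trans h
      nonneg := (R.perturbation σ hσ).nonneg.trans h }
  obs_local := R.obs_local; rep := R.rep

/-- The W-class is monotone in the radius. -/
theorem blockedActivityClassW_mono {N : ℕ} {ρ : G →* Matrix (Fin N) (Fin N) ℂ} {β : ℝ} {b n : ℕ} {a a' : ℝ}
    (hC : BlockedActivityClassW ρ β b n a) (h : a ≤ a') : BlockedActivityClassW ρ β b n a' := fun w hw Y hY h0 τ => by
  obtain ⟨R⟩ := hC w hw Y hY h0 τ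
  exact ⟨R.weaken G h⟩

/-- The radius tends to `0` along the meshes, uniformly in the strong window: `meshRadiusSC N β b n ≤ exp(3072 e · b⁴ 4^{−b}) − 1` for
`216N|β| ≤ 1`, `n ≥ 1`, and `b⁴ 4^{−b} → 0`. -/
theorem meshRadiusSC_le_uniform {N : ℕ} {β : ℝ} (hβ : 216 * (N : ℝ) * |β| ≤ 1) (b : ℕ) {n : ℕ} (hn : 1 ≤ n) :
    meshRadiusSC N β b n ≤ Real.exp (3072 * Real.exp 1 * ((b : ℝ) ^ 4 * (1 / 4 : ℝ) ^ b)) - 1 := by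
  refine sub_le_sub_right (Real.exp_le_exp.2 ?_) 1
  have he : Real.exp (24 * N * |β|) ≤ Real.exp 1 := Real.exp_le_exp.2 (by nlinarith [abs_nonneg β, Nat.cast_nonneg (α := ℝ) N])
  have hq : (1 / 2 : ℝ) ^ (2 * n * b) ≤ (1 / 4 : ℝ) ^ b := by
    rw [show (1 / 4 : ℝ) = (1 / 2) ^ 2 by norm_num, ← pow_mul]
    exact pow_le_pow_of_le_one (by norm_num) (by norm_num) (by nlinarith)
  have hb4 : 0 ≤ (b : ℝ) ^ 4 := by positivity
  calc 3072 * (b : ℝ) ^ 4 * Real.exp (24 * N * |β|) * (1 / 2 : ℝ) ^ (2 * n * b)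
      ≤ 3072 * (b : ℝ) ^ 4 * Real.exp 1 * (1 / 4 : ℝ) ^ b := by
        gcongr
    _ = 3072 * Real.exp 1 * ((b : ℝ) ^ 4 * (1 / 4 : ℝ) ^ b) := by ring

/-- **For every radius `a > 0` the class of record holds at ALL large meshes, uniformly in the strong window** (`n ≥ 1` fixed): the opposite of
the `b⁻⁴` re-indexing window of `BlockedActivityCalibrationMesh` — after integrating out (here: one conditional expectation) blocking IMPROVES the
activity radius exponentially in the mesh. -/
theorem blockedActivityClassW_strongCoupling_eventually {a : ℝ} (ha : 0 < a) {n : ℕ} (hn : 1 ≤ n) :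
    ∃ b₀ : ℕ, 1 ≤ b₀ ∧ ∀ b : ℕ, b₀ ≤ b → ∀ β : ℝ, 216 * (r.N : ℝ) * |β| ≤ 1 → BlockedActivityClassW r.ρ β b n a := by
  -- `b⁴ (1/4)^b → 0`, hence the uniform majorant of the radius is eventually `≤ a`
  have hlim : Filter.Tendsto (fun b : ℕ => (b : ℝ) ^ 4 * (1 / 4 : ℝ) ^ b) Filter.atTop (nhds 0) :=
    tendsto_pow_const_mul_const_pow_of_abs_lt_one 4 (by rw [abs_of_nonneg (by norm_num)]; norm_num)
  have hcont : Filter.Tendsto (fun t : ℝ => Real.exp (3072 * Real.exp 1 * t) - 1) (nhds 0) (nhds (Real.exp (3072 * Real.exp 1 * 0) - 1)) :=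
    ((Real.continuous_exp.comp (continuous_const.mul continuous_id)).sub continuous_const).continuousAt.tendsto
  rw [mul_zero, Real.exp_zero, sub_self] at hcont
  have hev := (hcont.comp hlim).eventually (gt_mem_nhds ha)
  obtain ⟨b₁, hb₁⟩ := Filter.eventually_atTop.1 hev
  refine ⟨max b₁ 1, le_max_right _ _, fun b hb β hβ => ?_⟩
  have hb1 : 1 ≤ b := (le_max_right _ _).trans hb
  have hmaj : meshRadiusSC r.N β b n ≤ a :=
    ((meshRadiusSC_le_uniform hβ b hn).trans (le_of_lt (hb₁ b ((le_max_left _ _).trans hb))))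
  exact blockedActivityClassW_mono G (blockedActivityClassW_strongCoupling_mesh G r hβ hb1 hn) hmaj

/-- **Certified instance at the KP hand-over radius**: at `(b, n) = (32, 1)` the strong-coupling radius is below `radiusKP (1∕3552)` (the
activity-axis number `a⋆ ∈ (2.81, 2.88)·10⁻⁹`, `BlockedActivityKP.radiusKP_bounds`): `meshRadiusSC N β 32 1 ≤ 10⁻⁹ ≤ (1∕3552)∕10⁵ < a⋆`
throughout `216N|β| ≤ 1` (arithmetic: `3072·32⁴·e·2^{−64} ≈ 4.7·10⁻¹⁰`, `e^{t} − 1 ≤ 2t` for `|t| ≤ 1`). -/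
theorem meshRadiusSC_32_le {N : ℕ} {β : ℝ} (hβ : 216 * (N : ℝ) * |β| ≤ 1) : meshRadiusSC N β 32 1 ≤ (1 : ℝ) / 10 ^ 9 := by
  set t : ℝ := 3072 * ((32 : ℕ) : ℝ) ^ 4 * Real.exp (24 * N * |β|) * (1 / 2 : ℝ) ^ (2 * 1 * 32) with ht
  have he : Real.exp (24 * N * |β|) ≤ Real.exp 1 := Real.exp_le_exp.2 (by nlinarith [abs_nonneg β, Nat.cast_nonneg (α := ℝ) N])
  have he1 : Real.exp 1 ≤ 2.7182818286 := Real.exp_one_lt_d9.le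
  have ht0 : 0 ≤ t := by positivity
  have htb : t ≤ 1 / (2 * 10 ^ 9) := by
    have : t ≤ 3072 * ((32 : ℕ) : ℝ) ^ 4 * 2.7182818286 * (1 / 2 : ℝ) ^ (2 * 1 * 32) := by
      rw [ht]; gcongr; exact he.trans he1
    refine this.trans ?_
    norm_num
  have habs : |t| ≤ 1 := by rw [abs_of_nonneg ht0]; linarith [htb]
  have hexp : |Real.exp t - 1| ≤ 2 * |t| := Real.abs_exp_sub_one_le habs
  rw [abs_of_nonneg ht0] at hexp
  have : meshRadiusSC N β 32 1 = Real.exp t - 1 := rfl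
  rw [this]
  calc Real.exp t - 1 ≤ |Real.exp t - 1| := le_abs_self _
    _ ≤ 2 * t := hexp
    _ ≤ 1 / 10 ^ 9 := by linarith [htb]

/-- **A hand-over INTO the KP ball AFTER BLOCKING, certified**: in the whole strong window the Wilson kernels are in the W-class of record at mesh
`32`, window `1`, with radius `radiusKP (1∕3552)` — the number `a⋆` of the activity axis — for every compact `G` and every lattice representation. -/
theorem blockedActivityClassW_32_radiusKP {β : ℝ} (hβ : 216 * (r.N : ℝ) * |β| ≤ 1) :
    BlockedActivityClassW r.ρ β 32 1 (radiusKP (1 / 3552)) := by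
  refine blockedActivityClassW_mono G (blockedActivityClassW_strongCoupling_mesh G r hβ (by norm_num) le_rfl) ?_
  refine (meshRadiusSC_32_le hβ).trans ?_
  have h := (radiusKP_bounds (ε := 1 / 3552) (by norm_num)).1
  refine le_trans (by norm_num) h.le

/-- … and back through the tree's sharp reduction: `UnivShellCond r.ρ β 32 1 (1∕3552)` at strong coupling, read THROUGH the activity currency
(class W at `a⋆` ⇒ the universal shell condition at the bootstrap accuracy `1∕3552`; `univShellCond_of_blockedActivityW_sharp`, p538158). -/
theorem univShellCond_32_strongCoupling {β : ℝ} (hβ : 216 * (r.N : ℝ) * |β| ≤ 1) :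
    OnsetFormats.UnivShellCond r.ρ β 32 1 (1 / 3552) :=
  univShellCond_of_blockedActivityW_sharp (blockedActivityClassW_32_radiusKP G r hβ) (by norm_num) le_rfl

end Main

end Summit.QuantumFields.YangMills.Cruxes.IR.BlockedActivity

end
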